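/-
Copyright: the b2b-balaban T⁴-continuum CRUX team, row NE7b, leaf prover `t4-ne7b-formalise-leaf-01` (gen 80), on the OWNER lineage
`t4-ne7b-p1` (gen 106)'s `TiltedMeanShift`; the refuter (gen 68)'s κ-ne7bref-g68-6 and idea-1 (gen 62)'s R-62-1. Project licence.
-/
import Summits.QuantumFields.BalabanUV.T4Continuum.Spine.NE7b.TiltedMeanShift
import Mathlib.Analysis.SpecificLimits.Basic

/-!
# THE INTERPOLATION FORM OF THE TILTED-MEAN SHIFT, DERIVATIVE-FREE: TELESCOPE the OWNER's one-step bound along `W + (k∕N)·P` in steps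
# `P∕N` and let `N → ∞` — `|𝔼_{W+P}⟪u,x⟫ − 𝔼_W⟪u,x⟫| ≤ λ⁻¹·((a∕2)‖u‖² + G∕(2a))`, `G = sup_{t∈[0,1]} 𝔼_{W+tP}‖∇P‖²`: NO `e^{∫P}`,
# NO `sup|P|` in the bound (row NE7b, node U5c; model level; the refuter's κ-ne7bref-g68-6 ∕ idea-1's R-62-1 «interpolation END»)

Cell `pub-balaban`, sub-cell `t4`, spine estimate NE7b (`T4WeightBudget.RelWeightBound` — the cell's OWN estimate, NOT PRINTED in
[Bałaban 1983–89], NOT PROVED).  Crux-route MODEL work under `Spine/NE7b/`; no `T4Continuum/Support` leaf, no `def`, no `Prop` minted,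
nothing of Bałaban's named or asserted; 0 `sorry`.

WHY.  The OWNER's `…NE7b.TiltedMeanShift.abs_tiltedMean_shift_le` (T-60e) bounds the shift of the tilted mean under a perturbation `P` of
a `λ`-uniformly convex `W` by `λ⁻¹·((a∕2)‖u‖² + 𝔼_W‖∇e^{−P}‖²∕(2a)) ∕ 𝔼_W e^{−P}` — derivative-free, but the END carries `e^{−P}` INSIDE
the expectations, and the refuter priced it (PRICING-NE7b v74 F405, κ-ne7bref-g68-6): after optimising `a` the bound is
`≈ λ⁻¹‖u‖²·e^{Var_W P}·…`, and for a REGION-extensive anharmonic remainder `Var_W P ≈ 10^{12.3}` at `ℓ⋆(1)` — UNAFFORDABLE; idea-1's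
INTERPOLATED form (R-62-1: `m′(t) = −Cov_{W+tP}(⟪u,x⟫, P)`, `|Δm| ≤ λ′⁻¹‖u‖·sup_t (𝔼_{W+tP}‖∇P‖²)^{1∕2}`, NO exponential of `P`) is
AFFORDABLE with room `10^{82}`, «the interpolation END is the one to add when a pen is free».  THIS FILE adds it WITHOUT DERIVATIVES
(no parametric differentiation under the integral, no covariance ODE): apply the OWNER's one-step theorem `N` times along the
interpolation `W_k = W + (k∕N)·P` with the perturbation `P∕N` (`tilted_tilted`: `ν_{W_k}.tilted(−P∕N) = ν_{W_{k+1}}`), TELESCOPE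
(`abs_sub_le_sum_of_steps`), and observe that with `|P| ≤ p` the `k`-th step costs at most
`e^{p∕N}·λ⁻¹·((a∕2)‖u‖² + e^{2p∕N}·N⁻²·G∕(2a))` (`𝔼 e^{−P∕N} ≥ e^{−p∕N}`; `‖∇e^{−P∕N}‖² = e^{−2P∕N}N⁻²‖∇P‖² ≤ e^{2p∕N}N⁻²‖∇P‖²`), so with
`a := a₀∕N` the `N` steps sum to `e^{3p∕N}·λ⁻¹·((a₀∕2)‖u‖² + G∕(2a₀))` (**`abs_tiltedMean_shift_le_telescoped`**) — and the LEFT side does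
not depend on `N`: letting `N → ∞` (`ge_of_tendsto`, `e^{3p∕N} → 1`) gives **`abs_tiltedMean_shift_le_interpolated`**:
`|𝔼_{W+P}⟪u,x⟫ − 𝔼_W⟪u,x⟫| ≤ λ⁻¹·((a₀∕2)‖u‖² + G∕(2a₀))` for every `a₀ > 0`, where `G` bounds `𝔼_{W+tP}‖∇P‖²` for `t ∈ [0,1]` and
`W + tP` is `λ`-uniformly convex for every `t ∈ [0,1]` (the refuter's `λ′ = 2σ − h` from `…ConvexTiltSuppliers` for all `t`).  The bound
`p` on `|P|` is a HYPOTHESIS ONLY — it does not enter the END (any finite `p`; for the road `P` is the Δ4-globalised near remainder on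
a window, bounded).  Optimising `a₀ = √G∕‖u‖` gives idea-1's `λ⁻¹‖u‖√G` (`abs_tiltedMean_shift_le_interpolated_sqrt`).

WHAT IS PROVED ([folklore]; the OWNER's `abs_tiltedMean_shift_le` and `norm_fderiv_exp_neg`, Mathlib `tilted_tilted`, `fderiv_const_mul`,
`Integrable.mono'` ∕ `Integrable.mul_bdd`, `tendsto_const_div_atTop_nhds_zero_nat`, `ge_of_tendsto`): `abs_sub_le_sum_of_steps`
(telescoping), `tilted_interpolate_succ` (the measure identity along the interpolation), `abs_tiltedMean_step_le` (the OWNER's theorem at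
`W + tP`, step `sP`), the by-value step suppliers `integral_exp_neg_smul_ge`, `norm_fderiv_exp_neg_smul_sq_le`,
`integral_norm_fderiv_exp_neg_smul_sq_le`, the integrabilities `integrable_exp_neg_smul(_sq)`, `integrable_norm_fderiv_exp_neg_smul_sq`,
`integrable_inner_mul_exp_neg_smul` (from `|P| ≤ p`, continuity and the displayed `‖∇P‖²`-integrability — the consumer supplies NO
`e^{−P}`-integrability), **`abs_tiltedMean_shift_le_telescoped`** (finite `N`), **`abs_tiltedMean_shift_le_interpolated`** (the END),
`abs_tiltedMean_shift_le_interpolated_sqrt` (optimised).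

NOT HERE (honest): the uniform convexity of `W + tP` along the interpolation and the size of `G` for Bałaban's anharmonic remainders
((R2′) family (2) readings — `…ConvexTiltSuppliers` gives the modulus `2σ − h` in the model); that `G` is REGION- not volume-extensive
(the near part only, as in the OWNER's SCOPE); the INTENSIVE letter (decay of `Cov(⟪u,·⟫, P_p)` in the distance — the (5.6) road);
anything of Bałaban's.  BY-NAME EFFECT ON THE WALL: NONE.  NE7b NOT PRINTED ∕ NOT PROVED; spine PROVED 0∕9; rung (B)+1 on a FINITE
torus — NOT infinite volume, NOT the mass gap, NOT Clay.
HONEST DEPENDENCY: continuum YM on T⁴ ⇐ BetaPertH ∧ nine spine estimates (0/9 proved); BetaPertH ⇐ (D1) ∧ (D4) ∧ CAP+tail;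
G-an2-4 gates asym, D1 and NE2/3/4.
-/

set_option autoImplicit false

noncomputable section

open MeasureTheory Real Finset Filter Topology
open scoped RealInnerProductSpace
open Summit.QuantumFields.BalabanUV.T4Continuum.NE7b.TiltedMeanShift

namespace Summit.QuantumFields.BalabanUV.T4Continuum.NE7b.TiltedMeanShiftInterpolated

/-! ## §1 Telescoping -/

/-- **TELESCOPING**: if `|m (k+1) − m k| ≤ B k` for `k < N` then `|m N − m 0| ≤ Σ_{k<N} B k`. [folklore] -/
theorem abs_sub_le_sum_of_steps (m B : ℕ → ℝ) :
    ∀ N : ℕ, (∀ k, k < N → |m (k + 1) - m k| ≤ B k) → |m N - m 0| ≤ ∑ k ∈ range N, B k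
  | 0, _ => by simp
  | N + 1, h => by
      have ih := abs_sub_le_sum_of_steps m B N fun k hk => h k (Nat.lt_succ_of_lt hk)
      calc |m (N + 1) - m 0| = |(m (N + 1) - m N) + (m N - m 0)| := by ring_nf
        _ ≤ |m (N + 1) - m N| + |m N - m 0| := abs_add_le _ _
        _ ≤ B N + ∑ k ∈ range N, B k := add_le_add (h N (Nat.lt_succ_self N)) ih
        _ = ∑ k ∈ range (N + 1), B k := by rw [sum_range_succ, add_comm]

/-! ## §2 One step along the interpolation `W + tP`: the OWNER's theorem with the perturbation `sP` -/

section Euclidean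

variable {n : ℕ}

/-- **THE MEASURE IDENTITY ALONG THE INTERPOLATION**: `ν_{W+(t+s)P} = ν_{W+tP}.tilted(−sP)` (`tilted_tilted`). [folklore] -/
theorem tilted_interpolate_succ {W P : EuclideanSpace ℝ (Fin n) → ℝ} {t s : ℝ}
    (hZ : Integrable fun x => exp (-(W x + t * P x))) :
    volume.tilted (fun x => -(W x + (t + s) * P x)) =
      (volume.tilted fun x => -(W x + t * P x)).tilted fun x => -(s * P x) := by
  rw [tilted_tilted hZ]
  congr 1
  funext x
  simp only [Pi.add_apply]
  ring

/-- **ONE STEP** (the OWNER's `abs_tiltedMean_shift_le` at the reference `W + tP` with the perturbation `sP`): under the `λ`-uniform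
convexity of `W + tP` (first-order letter), integrability of `e^{−(W+tP)}`, `P ∈ C¹`, and the displayed integrabilities under `ν_{W+tP}`,
`|𝔼_{W+(t+s)P}⟪u,x⟫ − 𝔼_{W+tP}⟪u,x⟫| ≤ λ⁻¹·((a∕2)‖u‖² + 𝔼_{W+tP}‖∇e^{−sP}‖²∕(2a)) ∕ 𝔼_{W+tP} e^{−sP}`. [folklore] -/
theorem abs_tiltedMean_step_le {W P : EuclideanSpace ℝ (Fin n) → ℝ} {lam a t s : ℝ} (hlam : 0 < lam) (ha : 0 < a)
    (hVc : Continuous fun x => W x + t * P x)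
    (hV : ∀ x y : EuclideanSpace ℝ (Fin n),
      (W x + t * P x) + ⟪gradient (fun z => W z + t * P z) x, y - x⟫ + lam / 2 * ‖y - x‖ ^ 2 ≤ W y + t * P y)
    (hZ : Integrable fun x => exp (-(W x + t * P x))) (hP : ContDiff ℝ 1 P) (u : EuclideanSpace ℝ (Fin n))
    (h1 : Integrable (fun x => ⟪u, x⟫) (volume.tilted fun x => -(W x + t * P x)))
    (h2 : Integrable (fun x => ⟪u, x⟫ ^ 2) (volume.tilted fun x => -(W x + t * P x)))
    (g1 : Integrable (fun x => exp (-(s * P x))) (volume.tilted fun x => -(W x + t * P x)))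
    (g2 : Integrable (fun x => exp (-(s * P x)) ^ 2) (volume.tilted fun x => -(W x + t * P x)))
    (g3 : Integrable (fun x => ‖fderiv ℝ (fun y => exp (-(s * P y))) x‖ ^ 2) (volume.tilted fun x => -(W x + t * P x)))
    (hfg : Integrable (fun x => ⟪u, x⟫ * exp (-(s * P x))) (volume.tilted fun x => -(W x + t * P x))) :
    |∫ x, ⟪u, x⟫ ∂(volume.tilted fun x => -(W x + (t + s) * P x)) -
        ∫ x, ⟪u, x⟫ ∂(volume.tilted fun x => -(W x + t * P x))| ≤
      lam⁻¹ * (a / 2 * ‖u‖ ^ 2 +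
          (∫ x, ‖fderiv ℝ (fun y => exp (-(s * P y))) x‖ ^ 2 ∂(volume.tilted fun x => -(W x + t * P x))) / (2 * a)) /
        ∫ x, exp (-(s * P x)) ∂(volume.tilted fun x => -(W x + t * P x)) := by
  rw [tilted_interpolate_succ hZ]
  exact abs_tiltedMean_shift_le (W := fun x => W x + t * P x) (P := fun x => s * P x) hlam ha hVc hV hZ
    (contDiff_const.mul hP) u h1 h2 g1 g2 g3 hfg

/-! ## §3 The step by value under `|P| ≤ p`: no `e^{−P}`-integrability is asked of the consumer -/

/-- A continuous function bounded in absolute value is integrable for a finite measure. [folklore] -/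
theorem integrable_of_continuous_of_abs_le {μ : Measure (EuclideanSpace ℝ (Fin n))} [IsFiniteMeasure μ]
    {f : EuclideanSpace ℝ (Fin n) → ℝ} (hf : Continuous f) {C : ℝ} (hC : ∀ x, |f x| ≤ C) : Integrable f μ :=
  (integrable_const C).mono' hf.aestronglyMeasurable (ae_of_all _ fun x => by rw [Real.norm_eq_abs]; exact hC x)

/-- `|P| ≤ p` ⟹ `e^{−sP x} ≤ e^{|s|p}`. [folklore] -/
theorem exp_neg_smul_le {P : EuclideanSpace ℝ (Fin n) → ℝ} {p s : ℝ} (hp : ∀ x, |P x| ≤ p) (x : EuclideanSpace ℝ (Fin n)) :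
    exp (-(s * P x)) ≤ exp (|s| * p) := by
  refine exp_le_exp.mpr ?_
  have h1 : -(s * P x) ≤ |s * P x| := neg_le_abs _
  have h2 : |s * P x| = |s| * |P x| := abs_mul _ _
  have h3 : |s| * |P x| ≤ |s| * p := mul_le_mul_of_nonneg_left (hp x) (abs_nonneg _)
  linarith

/-- `|P| ≤ p` ⟹ `e^{−|s|p} ≤ e^{−sP x}`. [folklore] -/
theorem exp_neg_smul_ge {P : EuclideanSpace ℝ (Fin n) → ℝ} {p s : ℝ} (hp : ∀ x, |P x| ≤ p) (x : EuclideanSpace ℝ (Fin n)) :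
    exp (-(|s| * p)) ≤ exp (-(s * P x)) := by
  refine exp_le_exp.mpr ?_
  have h1 : s * P x ≤ |s * P x| := le_abs_self _
  have h2 : |s * P x| = |s| * |P x| := abs_mul _ _
  have h3 : |s| * |P x| ≤ |s| * p := mul_le_mul_of_nonneg_left (hp x) (abs_nonneg _)
  linarith

/-- `e^{−sP}` is integrable for any finite measure when `P` is continuous with `|P| ≤ p`. [folklore] -/
theorem integrable_exp_neg_smul {μ : Measure (EuclideanSpace ℝ (Fin n))} [IsFiniteMeasure μ]
    {P : EuclideanSpace ℝ (Fin n) → ℝ} (hPc : Continuous P) {p : ℝ} (hp : ∀ x, |P x| ≤ p) (s : ℝ) :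
    Integrable (fun x => exp (-(s * P x))) μ :=
  integrable_of_continuous_of_abs_le (by fun_prop) (C := exp (|s| * p)) fun x => by
    rw [abs_of_pos (exp_pos _)]; exact exp_neg_smul_le hp x

/-- `(e^{−sP})²` is integrable likewise. [folklore] -/
theorem integrable_exp_neg_smul_sq {μ : Measure (EuclideanSpace ℝ (Fin n))} [IsFiniteMeasure μ]
    {P : EuclideanSpace ℝ (Fin n) → ℝ} (hPc : Continuous P) {p : ℝ} (hp : ∀ x, |P x| ≤ p) (s : ℝ) :
    Integrable (fun x => exp (-(s * P x)) ^ 2) μ :=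
  integrable_of_continuous_of_abs_le (by fun_prop) (C := exp (|s| * p) ^ 2) fun x => by
    rw [abs_of_nonneg (sq_nonneg _)]
    exact pow_le_pow_left₀ (exp_pos _).le (exp_neg_smul_le hp x) 2

/-- `⟪u,x⟫·e^{−sP}` is integrable when `⟪u,x⟫` is (bounded continuous factor). [folklore] -/
theorem integrable_inner_mul_exp_neg_smul {μ : Measure (EuclideanSpace ℝ (Fin n))}
    {P : EuclideanSpace ℝ (Fin n) → ℝ} (hPc : Continuous P) {p : ℝ} (hp : ∀ x, |P x| ≤ p) (s : ℝ) (u : EuclideanSpace ℝ (Fin n))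
    (h1 : Integrable (fun x => ⟪u, x⟫) μ) :
    Integrable (fun x => ⟪u, x⟫ * exp (-(s * P x))) μ :=
  h1.mul_bdd (by fun_prop : Continuous fun x => exp (-(s * P x))).aestronglyMeasurable
    (ae_of_all _ fun x => by rw [Real.norm_eq_abs, abs_of_pos (exp_pos _)]; exact exp_neg_smul_le hp x)

/-- **THE GRADIENT OF `e^{−sP}` BY VALUE**: `‖∇e^{−sP}(x)‖² ≤ e^{2|s|p}·s²·‖∇P(x)‖²` for `P ∈ C¹`, `|P| ≤ p` (the OWNER's
`norm_fderiv_exp_neg` and `fderiv_const_mul`). [folklore] -/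
theorem norm_fderiv_exp_neg_smul_sq_le {P : EuclideanSpace ℝ (Fin n) → ℝ} (hP : ContDiff ℝ 1 P) {p : ℝ} (hp : ∀ x, |P x| ≤ p)
    (s : ℝ) (x : EuclideanSpace ℝ (Fin n)) :
    ‖fderiv ℝ (fun y => exp (-(s * P y))) x‖ ^ 2 ≤ exp (|s| * p) ^ 2 * (s ^ 2 * ‖fderiv ℝ P x‖ ^ 2) := by
  have hPd : DifferentiableAt ℝ P x := hP.differentiable one_ne_zero x
  have hsPd : DifferentiableAt ℝ (fun y => s * P y) x := hPd.const_mul s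
  have e1 : ‖fderiv ℝ (fun y => exp (-(s * P y))) x‖ = exp (-(s * P x)) * ‖fderiv ℝ (fun y => s * P y) x‖ :=
    norm_fderiv_exp_neg (P := fun y => s * P y) hsPd
  have e2 : ‖fderiv ℝ (fun y => s * P y) x‖ = |s| * ‖fderiv ℝ P x‖ := by
    rw [fderiv_const_mul hPd s, norm_smul, Real.norm_eq_abs]
  rw [e1, e2, mul_pow, mul_pow, sq_abs]
  exact mul_le_mul_of_nonneg_right (pow_le_pow_left₀ (exp_pos _).le (exp_neg_smul_le hp x) 2) (by positivity)

/-- `‖∇e^{−sP}‖²` is integrable when `‖∇P‖²` is (`P ∈ C¹`, `|P| ≤ p`). [folklore] -/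
theorem integrable_norm_fderiv_exp_neg_smul_sq {μ : Measure (EuclideanSpace ℝ (Fin n))}
    {P : EuclideanSpace ℝ (Fin n) → ℝ} (hP : ContDiff ℝ 1 P) {p : ℝ} (hp : ∀ x, |P x| ≤ p) (s : ℝ)
    (hgrad : Integrable (fun x => ‖fderiv ℝ P x‖ ^ 2) μ) :
    Integrable (fun x => ‖fderiv ℝ (fun y => exp (-(s * P y))) x‖ ^ 2) μ := by
  have hc : Continuous fun x => ‖fderiv ℝ (fun y => exp (-(s * P y))) x‖ ^ 2 :=
    (((contDiff_const.mul hP).neg.exp).continuous_fderiv one_ne_zero).norm.pow 2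
  refine (hgrad.const_mul (exp (|s| * p) ^ 2 * s ^ 2)).mono' hc.aestronglyMeasurable (ae_of_all _ fun x => ?_)
  rw [Real.norm_eq_abs, abs_of_nonneg (sq_nonneg _), mul_assoc]
  exact norm_fderiv_exp_neg_smul_sq_le hP hp s x

/-- **THE DENOMINATOR BY VALUE**: for a probability measure, `e^{−|s|p} ≤ ∫ e^{−sP}`. [folklore] -/
theorem integral_exp_neg_smul_ge {μ : Measure (EuclideanSpace ℝ (Fin n))} [IsProbabilityMeasure μ]
    {P : EuclideanSpace ℝ (Fin n) → ℝ} (hPc : Continuous P) {p : ℝ} (hp : ∀ x, |P x| ≤ p) (s : ℝ) :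
    exp (-(|s| * p)) ≤ ∫ x, exp (-(s * P x)) ∂μ := by
  have h := integral_mono (integrable_const (exp (-(|s| * p)))) (integrable_exp_neg_smul (μ := μ) hPc hp s)
    fun x => exp_neg_smul_ge hp x
  rwa [integral_const, smul_eq_mul, probReal_univ, one_mul] at h

/-- **THE GRADIENT TERM BY VALUE**: `∫‖∇e^{−sP}‖² ≤ e^{2|s|p}·s²·∫‖∇P‖²`. [folklore] -/
theorem integral_norm_fderiv_exp_neg_smul_sq_le {μ : Measure (EuclideanSpace ℝ (Fin n))}
    {P : EuclideanSpace ℝ (Fin n) → ℝ} (hP : ContDiff ℝ 1 P) {p : ℝ} (hp : ∀ x, |P x| ≤ p) (s : ℝ)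
    (hgrad : Integrable (fun x => ‖fderiv ℝ P x‖ ^ 2) μ) :
    ∫ x, ‖fderiv ℝ (fun y => exp (-(s * P y))) x‖ ^ 2 ∂μ ≤ exp (|s| * p) ^ 2 * (s ^ 2 * ∫ x, ‖fderiv ℝ P x‖ ^ 2 ∂μ) := by
  rw [← integral_const_mul, ← integral_const_mul]
  exact integral_mono (integrable_norm_fderiv_exp_neg_smul_sq hP hp s hgrad) ((hgrad.const_mul _).const_mul _)
    fun x => norm_fderiv_exp_neg_smul_sq_le hP hp s x

/-! ## §4 The telescoped bound (finite `N`) and the interpolation END (`N → ∞`) -/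

/-- **THE TELESCOPED TILTED-MEAN SHIFT (finite `N`).**  `W` continuous, `P ∈ C¹` with `|P| ≤ p`; for every `t ∈ [0,1]` the
interpolant `W + tP` is `λ`-uniformly convex (first-order letter), `e^{−(W+tP)}` is integrable, and under `ν_t = volume.tilted(−(W+tP))`
the test function `⟪u,·⟫` has two moments and `‖∇P‖²` is integrable with `∫‖∇P‖² dν_t ≤ G`.  Then for every `N ≥ 1` and `a₀ > 0`:
`|𝔼_{W+P}⟪u,x⟫ − 𝔼_W⟪u,x⟫| ≤ e^{3p∕N}·λ⁻¹·((a₀∕2)‖u‖² + G∕(2a₀))`. [folklore] -/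
theorem abs_tiltedMean_shift_le_telescoped {W P : EuclideanSpace ℝ (Fin n) → ℝ} {lam a₀ p G : ℝ} (hlam : 0 < lam) (ha₀ : 0 < a₀)
    (hWc : Continuous W) (hP : ContDiff ℝ 1 P) (hp : ∀ x, |P x| ≤ p)
    (hV : ∀ t ∈ Set.Icc (0 : ℝ) 1, ∀ x y : EuclideanSpace ℝ (Fin n),
      (W x + t * P x) + ⟪gradient (fun z => W z + t * P z) x, y - x⟫ + lam / 2 * ‖y - x‖ ^ 2 ≤ W y + t * P y)
    (hZ : ∀ t ∈ Set.Icc (0 : ℝ) 1, Integrable fun x => exp (-(W x + t * P x))) (u : EuclideanSpace ℝ (Fin n))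
    (h1 : ∀ t ∈ Set.Icc (0 : ℝ) 1, Integrable (fun x => ⟪u, x⟫) (volume.tilted fun x => -(W x + t * P x)))
    (h2 : ∀ t ∈ Set.Icc (0 : ℝ) 1, Integrable (fun x => ⟪u, x⟫ ^ 2) (volume.tilted fun x => -(W x + t * P x)))
    (hgrad : ∀ t ∈ Set.Icc (0 : ℝ) 1, Integrable (fun x => ‖fderiv ℝ P x‖ ^ 2) (volume.tilted fun x => -(W x + t * P x)))
    (hG : ∀ t ∈ Set.Icc (0 : ℝ) 1, ∫ x, ‖fderiv ℝ P x‖ ^ 2 ∂(volume.tilted fun x => -(W x + t * P x)) ≤ G)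
    {N : ℕ} (hN : 0 < N) :
    |∫ x, ⟪u, x⟫ ∂(volume.tilted fun x => -(W x + P x)) - ∫ x, ⟪u, x⟫ ∂(volume.tilted fun x => -W x)| ≤
      exp (3 * p / N) * (lam⁻¹ * (a₀ / 2 * ‖u‖ ^ 2 + G / (2 * a₀))) := by
  have hNr : (0 : ℝ) < N := Nat.cast_pos.mpr hN
  have hp0 : 0 ≤ p := (abs_nonneg _).trans (hp 0)
  have hPc : Continuous P := hP.continuous
  -- the interpolating means
  set m : ℕ → ℝ := fun k => ∫ x, ⟪u, x⟫ ∂(volume.tilted fun x => -(W x + (k : ℝ) / N * P x)) with hm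
  -- the step size and the per-step constant bound
  set s : ℝ := 1 / N with hs
  have hs0 : 0 < s := by rw [hs]; positivity
  have hsabs : |s| = s := abs_of_pos hs0
  set a : ℝ := a₀ / N with hadef
  have ha : 0 < a := by rw [hadef]; positivity
  set B : ℝ := exp (s * p) * (lam⁻¹ * (a / 2 * ‖u‖ ^ 2 + exp (s * p) ^ 2 * (s ^ 2 * G) / (2 * a))) with hB
  -- each step is bounded by `B`
  have step : ∀ k, k < N → |m (k + 1) - m k| ≤ B := by
    intro k hk
    have htk : ((k : ℝ) / N) ∈ Set.Icc (0 : ℝ) 1 :=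
      ⟨by positivity, (div_le_one hNr).mpr (by exact_mod_cast hk.le)⟩
    haveI : IsProbabilityMeasure (volume.tilted fun x : EuclideanSpace ℝ (Fin n) => -(W x + (k : ℝ) / N * P x)) :=
      isProbabilityMeasure_tilted (hZ _ htk)
    have hVc : Continuous fun x => W x + (k : ℝ) / N * P x := hWc.add (continuous_const.mul hPc)
    have e_succ : ((k + 1 : ℕ) : ℝ) / N = (k : ℝ) / N + s := by rw [hs]; push_cast; ring
    have key := abs_tiltedMean_step_le (t := (k : ℝ) / N) (s := s) hlam ha hVc (hV _ htk) (hZ _ htk) hP u (h1 _ htk) (h2 _ htk)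
      (integrable_exp_neg_smul hPc hp s) (integrable_exp_neg_smul_sq hPc hp s)
      (integrable_norm_fderiv_exp_neg_smul_sq hP hp s (hgrad _ htk)) (integrable_inner_mul_exp_neg_smul hPc hp s u (h1 _ htk))
    have hm1 : m (k + 1) = ∫ x, ⟪u, x⟫ ∂(volume.tilted fun x => -(W x + ((k : ℝ) / N + s) * P x)) := by
      simp only [hm, e_succ]
    rw [hm1]
    refine key.trans ?_
    -- numerator and denominator by value
    have hD : exp (-(s * p)) ≤ ∫ x, exp (-(s * P x)) ∂(volume.tilted fun x => -(W x + (k : ℝ) / N * P x)) := by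
      have := integral_exp_neg_smul_ge (μ := volume.tilted fun x => -(W x + (k : ℝ) / N * P x)) hPc hp s
      rwa [hsabs] at this
    have hI : ∫ x, ‖fderiv ℝ (fun y => exp (-(s * P y))) x‖ ^ 2 ∂(volume.tilted fun x => -(W x + (k : ℝ) / N * P x)) ≤
        exp (s * p) ^ 2 * (s ^ 2 * G) := by
      have := integral_norm_fderiv_exp_neg_smul_sq_le (μ := volume.tilted fun x => -(W x + (k : ℝ) / N * P x)) hP hp s (hgrad _ htk)
      rw [hsabs] at this
      exact this.trans (mul_le_mul_of_nonneg_left (mul_le_mul_of_nonneg_left (hG _ htk) (sq_nonneg _)) (sq_nonneg _))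
    have hnum_nonneg : 0 ≤ lam⁻¹ * (a / 2 * ‖u‖ ^ 2 + exp (s * p) ^ 2 * (s ^ 2 * G) / (2 * a)) := by
      have hG0 : 0 ≤ G := (integral_nonneg fun x => sq_nonneg _).trans (hG _ htk)
      positivity
    calc lam⁻¹ * (a / 2 * ‖u‖ ^ 2 +
            (∫ x, ‖fderiv ℝ (fun y => exp (-(s * P y))) x‖ ^ 2 ∂(volume.tilted fun x => -(W x + (k : ℝ) / N * P x))) / (2 * a)) /
          ∫ x, exp (-(s * P x)) ∂(volume.tilted fun x => -(W x + (k : ℝ) / N * P x))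
        ≤ lam⁻¹ * (a / 2 * ‖u‖ ^ 2 + exp (s * p) ^ 2 * (s ^ 2 * G) / (2 * a)) /
            ∫ x, exp (-(s * P x)) ∂(volume.tilted fun x => -(W x + (k : ℝ) / N * P x)) :=
          div_le_div_of_nonneg_right
            (mul_le_mul_of_nonneg_left
              (add_le_add le_rfl (div_le_div_of_nonneg_right hI (by positivity : (0 : ℝ) ≤ 2 * a)))
              (inv_pos.mpr hlam).le)
            ((exp_pos _).le.trans hD)
      _ ≤ lam⁻¹ * (a / 2 * ‖u‖ ^ 2 + exp (s * p) ^ 2 * (s ^ 2 * G) / (2 * a)) / exp (-(s * p)) :=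
          div_le_div_of_nonneg_left hnum_nonneg (exp_pos _) hD
      _ = B := by rw [hB, exp_neg, div_inv_eq_mul, mul_comm]
  -- telescope
  have tel := abs_sub_le_sum_of_steps m (fun _ => B) N step
  have e0 : m 0 = ∫ x, ⟪u, x⟫ ∂(volume.tilted fun x => -W x) := by
    simp only [hm, Nat.cast_zero, zero_div, zero_mul, add_zero]
  have eN : m N = ∫ x, ⟪u, x⟫ ∂(volume.tilted fun x => -(W x + P x)) := by
    simp only [hm, div_self hNr.ne', one_mul]
  rw [← eN, ← e0]
  refine tel.trans ?_
  rw [sum_const, card_range, nsmul_eq_mul]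
  -- the arithmetic: `N·B = e^{p∕N}·λ⁻¹·((a₀∕2)‖u‖² + e^{2p∕N}·G∕(2a₀)) ≤ e^{3p∕N}·λ⁻¹·((a₀∕2)‖u‖² + G∕(2a₀))`
  have hG0 : 0 ≤ G := (integral_nonneg fun x => sq_nonneg _).trans (hG 0 ⟨le_rfl, zero_le_one⟩)
  have e1 : (N : ℝ) * B = exp (s * p) * (lam⁻¹ * (a₀ / 2 * ‖u‖ ^ 2 + exp (s * p) ^ 2 * G / (2 * a₀))) := by
    rw [hB, hadef, hs]
    field_simp
  rw [e1]
  have e3 : exp (3 * p / N) = exp (s * p) * exp (s * p) ^ 2 := by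
    rw [sq, ← exp_add, ← exp_add]; congr 1; rw [hs]; ring
  rw [e3, mul_assoc]
  refine mul_le_mul_of_nonneg_left ?_ (exp_pos _).le
  have hsq1 : 1 ≤ exp (s * p) ^ 2 := one_le_pow₀ (one_le_exp (by positivity))
  rw [← mul_assoc, mul_comm (exp (s * p) ^ 2) lam⁻¹, mul_assoc]
  refine mul_le_mul_of_nonneg_left ?_ (inv_pos.mpr hlam).le
  rw [mul_add]
  refine add_le_add ?_ (le_of_eq ?_)
  · exact le_mul_of_one_le_left (by positivity) hsq1
  · ring

/-- **THE INTERPOLATION FORM OF THE TILTED-MEAN SHIFT (idea-1's R-62-1 ∕ the refuter's κ-ne7bref-g68-6 END), DERIVATIVE-FREE.**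
Under the hypotheses of `abs_tiltedMean_shift_le_telescoped` (uniform convexity of `W + tP` and `∫‖∇P‖² dν_{W+tP} ≤ G` along `t ∈ [0,1]`,
`|P| ≤ p` for SOME `p` — which does not enter the bound), for every `a₀ > 0`:
`|𝔼_{W+P}⟪u,x⟫ − 𝔼_W⟪u,x⟫| ≤ λ⁻¹·((a₀∕2)‖u‖² + G∕(2a₀))` — NO `e^{∫P}`, NO `sup|P|`: the letter `N → ∞` of the telescoped bound.
[folklore] -/
theorem abs_tiltedMean_shift_le_interpolated {W P : EuclideanSpace ℝ (Fin n) → ℝ} {lam a₀ p G : ℝ} (hlam : 0 < lam)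
    (ha₀ : 0 < a₀) (hWc : Continuous W) (hP : ContDiff ℝ 1 P) (hp : ∀ x, |P x| ≤ p)
    (hV : ∀ t ∈ Set.Icc (0 : ℝ) 1, ∀ x y : EuclideanSpace ℝ (Fin n),
      (W x + t * P x) + ⟪gradient (fun z => W z + t * P z) x, y - x⟫ + lam / 2 * ‖y - x‖ ^ 2 ≤ W y + t * P y)
    (hZ : ∀ t ∈ Set.Icc (0 : ℝ) 1, Integrable fun x => exp (-(W x + t * P x))) (u : EuclideanSpace ℝ (Fin n))
    (h1 : ∀ t ∈ Set.Icc (0 : ℝ) 1, Integrable (fun x => ⟪u, x⟫) (volume.tilted fun x => -(W x + t * P x)))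
    (h2 : ∀ t ∈ Set.Icc (0 : ℝ) 1, Integrable (fun x => ⟪u, x⟫ ^ 2) (volume.tilted fun x => -(W x + t * P x)))
    (hgrad : ∀ t ∈ Set.Icc (0 : ℝ) 1, Integrable (fun x => ‖fderiv ℝ P x‖ ^ 2) (volume.tilted fun x => -(W x + t * P x)))
    (hG : ∀ t ∈ Set.Icc (0 : ℝ) 1, ∫ x, ‖fderiv ℝ P x‖ ^ 2 ∂(volume.tilted fun x => -(W x + t * P x)) ≤ G) :
    |∫ x, ⟪u, x⟫ ∂(volume.tilted fun x => -(W x + P x)) - ∫ x, ⟪u, x⟫ ∂(volume.tilted fun x => -W x)| ≤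
      lam⁻¹ * (a₀ / 2 * ‖u‖ ^ 2 + G / (2 * a₀)) := by
  set C := lam⁻¹ * (a₀ / 2 * ‖u‖ ^ 2 + G / (2 * a₀)) with hC
  -- `e^{3p∕N}·C → C`
  have hlim : Tendsto (fun N : ℕ => exp (3 * p / (N : ℝ)) * C) atTop (𝓝 C) := by
    have h3 : Tendsto (fun N : ℕ => 3 * p / (N : ℝ)) atTop (𝓝 0) := tendsto_const_div_atTop_nhds_zero_nat (3 * p)
    have h4 := ((continuous_exp.tendsto 0).comp h3).mul_const C
    rwa [exp_zero, one_mul] at h4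
  refine ge_of_tendsto hlim (Filter.eventually_atTop.2 ⟨1, fun N hN => ?_⟩)
  exact abs_tiltedMean_shift_le_telescoped hlam ha₀ hWc hP hp hV hZ u h1 h2 hgrad hG hN

/-- The same with `a₀` optimised: `|𝔼_{W+P}⟪u,x⟫ − 𝔼_W⟪u,x⟫| ≤ λ⁻¹·‖u‖·√G` (for `u ≠ 0`, `G > 0`; take `a₀ = √G∕‖u‖`). [folklore] -/
theorem abs_tiltedMean_shift_le_interpolated_sqrt {W P : EuclideanSpace ℝ (Fin n) → ℝ} {lam p G : ℝ} (hlam : 0 < lam)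
    (hWc : Continuous W) (hP : ContDiff ℝ 1 P) (hp : ∀ x, |P x| ≤ p)
    (hV : ∀ t ∈ Set.Icc (0 : ℝ) 1, ∀ x y : EuclideanSpace ℝ (Fin n),
      (W x + t * P x) + ⟪gradient (fun z => W z + t * P z) x, y - x⟫ + lam / 2 * ‖y - x‖ ^ 2 ≤ W y + t * P y)
    (hZ : ∀ t ∈ Set.Icc (0 : ℝ) 1, Integrable fun x => exp (-(W x + t * P x))) {u : EuclideanSpace ℝ (Fin n)} (hu : u ≠ 0)
    (h1 : ∀ t ∈ Set.Icc (0 : ℝ) 1, Integrable (fun x => ⟪u, x⟫) (volume.tilted fun x => -(W x + t * P x)))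
    (h2 : ∀ t ∈ Set.Icc (0 : ℝ) 1, Integrable (fun x => ⟪u, x⟫ ^ 2) (volume.tilted fun x => -(W x + t * P x)))
    (hgrad : ∀ t ∈ Set.Icc (0 : ℝ) 1, Integrable (fun x => ‖fderiv ℝ P x‖ ^ 2) (volume.tilted fun x => -(W x + t * P x)))
    (hGpos : 0 < G)
    (hG : ∀ t ∈ Set.Icc (0 : ℝ) 1, ∫ x, ‖fderiv ℝ P x‖ ^ 2 ∂(volume.tilted fun x => -(W x + t * P x)) ≤ G) :
    |∫ x, ⟪u, x⟫ ∂(volume.tilted fun x => -(W x + P x)) - ∫ x, ⟪u, x⟫ ∂(volume.tilted fun x => -W x)| ≤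
      lam⁻¹ * (‖u‖ * Real.sqrt G) := by
  have hu' : 0 < ‖u‖ := norm_pos_iff.mpr hu
  have hsG : 0 < Real.sqrt G := Real.sqrt_pos.mpr hGpos
  have key := abs_tiltedMean_shift_le_interpolated (a₀ := Real.sqrt G / ‖u‖) hlam (by positivity) hWc hP hp hV hZ u h1 h2 hgrad hG
  refine key.trans (le_of_eq ?_)
  congr 1
  have hGe : G = Real.sqrt G * Real.sqrt G := (Real.mul_self_sqrt hGpos.le).symm
  field_simp
  nlinarith [hGe, hu', hsG]

end Euclidean

end Summit.QuantumFields.BalabanUV.T4Continuum.NE7b.TiltedMeanShiftInterpolated
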